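import Mathlib
import HarnessLib
import Literature.Analysis.FluidPDE.VorticityCalculus
import Literature.Analysis.FluidPDE.VorticityStretching
import Literature.Analysis.FluidPDE.AncientSimilarityVorticity
import Literature.Analysis.FluidPDE.IsometryInvariance
import Literature.Analysis.FluidPDE.CurlIsometryCovariance
import Summits.NavierStokesRegularity.NavierStokesRegularity.Theorems.TypeIQuarterGateScarEnvelopeTypeIForcedTsaiDefs
import Summits.NavierStokesRegularity.NavierStokesRegularity.Theorems.TypeIQuarterGateScarEnvelopeTypeIForcedTsaiTypeIDefs

/-!
# ARM B — LINEAR-FLOOR §2(a) in the kernel: the VORTICITY FORM of the registered residual and the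
  O(3)-INVARIANCE of both registered quadratic forms (ns-wall-extremal, DATUM B-2j / B-2l / B-2n)

Cell ns-wall-extremal, seat ns-wall-eng-1 g7 (owner lineage of the linear floor of record).  The words of
record for the class-free linear floor `κ_lin = κ(1) ∈ [14.8582872, 14.8582893]` (ns-wall-crit-1 g4,
2026-08-29T05:32:53Z) read «modulo ONLY the analytic SO(3) sector reduction (eng-1 LINEAR-FLOOR §2)».
That §2 has two parts:

(a) OPERATOR CALCULUS — «`curl(LU) = Aω` with `ω = curl U`, `A = −Δ + 1 + ½ y·∇` acting on each
    Cartesian component (`curl(y·∇U) = ω + y·∇ω`); `A`, the radial weight `(1+|y|)⁵` and the ball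
    `B₁₀` commute with the SO(3) action `(RU)(y) = R U(Rᵀy)`»;
(b) REPRESENTATION THEORY — the decomposition of divergence-free fields into toroidal/poloidal
    `SO(3)`-sectors and the radial reduction to the operators `T_ℓ`, plus five computed radial problems.

THIS FILE IS (a), AS THEOREMS OVER THE REGISTERED CURRENCY of `…ForcedTsaiDefs`
(`lerayMomentumResidual`, `lerayVorticityResidual g`, `lerayLevel = ‖curl U‖_{L²(B₁₀)}`,
`lerayResidualNorm = ‖(1+|y|)^{5/2} g‖_{L²}`) — assembled from tree lemmas only
(`curl_laplacian`, `curl_fderiv_apply_self`, `curl_convect_self_of_isDivFree`,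
`IsometryInvariance.{laplacian,fderiv,convect}_conj_linearIsometryEquiv`,
`CurlIsometryCovariance.curl_conj_linearIsometryEquiv`, Mathlib `LinearIsometryEquiv.measurePreserving`).
Part (b) stays ANALYTIC / numeric and is NOT claimed here.

WHAT IS PROVED (theorem-only; standard axioms; no number of record changes):

* `curl_linearisedLeray` — for `U ∈ C³(ℝ³;ℝ³)`:
  `curl(−ΔU + ½U + ½DU·y) = −Δω + ω + ½Dω·y`, `ω = curl U` (§2 line 1, the operator `A`);
* `lerayVorticityResidual_eq_vorticityForm` — the REGISTERED residual in vorticity variables: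
  `g = −Δω + ω + ½Dω·y + curl((U·∇)U)`, and `…_of_isDivFree`:
  `g = −Δω + ω + ½Dω·y + Dω(U) − DU(ω)` for divergence-free `U` (the steady backward
  self-similar vorticity equation's left side; cf. `IsBackwardLeraySolutionOn.vorticity_eq`);
* O(3) COVARIANCE, for every linear isometry `R` of `ℝ³` and `U_R := R ∘ U ∘ R⁻¹`, with NO
  hypotheses on `U` (junk values transform too): `lerayMomentumResidual_conj`
  (`= R (lerayMomentumResidual U (R⁻¹y))`), `lerayVorticityResidual_conj`
  (`= det R • R (g_U(R⁻¹y))`, the vorticity residual is a pseudovector),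
  `norm_lerayVorticityResidual_conj`;
* INVARIANCE OF THE TWO REGISTERED QUADRATIC FORMS: `lerayLevel_conj`, `lerayResidualNorm_conj`,
  `integrable_residualWeight_conj_iff`; with `contDiff_conj`, the tree's
  `IsDivFree.conj_linearIsometryEquiv` and `typeIDecay_conj` this gives
  `forcedTsaiWitness_conj` / `forcedTsaiTypeIWitness_conj`: the witness predicates behind
  `ForcedTsaiModulusLE M δ` and `ForcedTsaiModulusTypeILE C₀ M δ` are O(3)-STABLE with the same
  `(C₀, M, δ)` — §2 line 2 for the full nonlinear registered pair, not only its linearisation.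

HONEST FRAME.  Identity-grade helpers (`--supports stmt-NavierStokesRegularity-23843`): they make
part (a) of the reduction by-name citable; they exclude nothing, bound no modulus, and say nothing
about Navier–Stokes regularity.  Crux `ScarEnvelopeTypeI` (stmt-23843) / wall H3 OPEN; NS regularity
NOT proved.
-/

noncomputable section

set_option linter.dupNamespace false

namespace Summit.NavierStokesRegularity.NavierStokesRegularity.Cruxes.ScarEnvelopeTypeI.ForcedTsai

open MeasureTheory Set Metric Filter Topology
open scoped ContDiff Laplacian InnerProductSpace RealInnerProductSpace
open Literature.Analysis.FluidPDE

/-! ## A. The vorticity form of the registered residual (LINEAR-FLOOR §2, line 1) -/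

section VorticityForm

variable {U : E3 → E3}

/-- Bookkeeping: for `U ∈ C³` the Laplacian `ΔU` is differentiable. -/
theorem differentiableAt_laplacian_of_contDiff_three (hU : ContDiff ℝ 3 U) (x : E3) :
    DifferentiableAt ℝ (Δ U) x :=
  ((contDiff_one_laplacian hU).differentiable one_ne_zero).differentiableAt

/-- Bookkeeping: for `U ∈ C²` the Leray transport term `y ↦ DU(y)[y]` is differentiable. -/
theorem differentiableAt_fderiv_apply_self (hU : ContDiff ℝ 2 U) (x : E3) :
    DifferentiableAt ℝ (fun y => fderiv ℝ U y y) x := by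
  have hD : DifferentiableAt ℝ (fderiv ℝ U) x :=
    ((hU.fderiv_right (m := 1) (by norm_num)).differentiable one_ne_zero).differentiableAt
  exact hD.clm_apply differentiableAt_id

/-- Bookkeeping: for `U ∈ C²` the self-advection `(U·∇)U = y ↦ DU(y)[U y]` is differentiable. -/
theorem differentiableAt_convect_self (hU : ContDiff ℝ 2 U) (x : E3) :
    DifferentiableAt ℝ (convect U U) x := by
  have hD : DifferentiableAt ℝ (fderiv ℝ U) x :=
    ((hU.fderiv_right (m := 1) (by norm_num)).differentiable one_ne_zero).differentiableAt
  have hUx : DifferentiableAt ℝ U x := (hU.differentiable (by simp)) x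
  show DifferentiableAt ℝ (fun y => fderiv ℝ U y (U y)) x
  exact hD.clm_apply hUx

/-- **LINEAR-FLOOR §2, line 1: `curl ∘ L = A ∘ curl`.**  For `U ∈ C³(ℝ³;ℝ³)` the curl of the
linearised Leray operator `LU = −ΔU + ½U + ½(y·∇)U` is `Aω = −Δω + ω + ½(y·∇)ω` with `ω = curl U`
(`curl Δ = Δ curl` and `curl((y·∇)U) = ω + (y·∇)ω`: the extra `½ω` is the derivative falling on
the coefficient `y`, so the zeroth-order coefficient of `A` is `1`, not `½`). -/
theorem curl_linearisedLeray (hU : ContDiff ℝ 3 U) (x : E3) :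
    curl (fun y => -((Δ U) y) + (1 / 2 : ℝ) • U y + (1 / 2 : ℝ) • fderiv ℝ U y y) x
      = -((Δ (curl U)) x) + curl U x + (1 / 2 : ℝ) • fderiv ℝ (curl U) x x := by
  have hU2 : ContDiff ℝ 2 U := hU.of_le (by norm_num)
  have hUx : DifferentiableAt ℝ U x := (hU.differentiable (by simp)) x
  have hΔ : DifferentiableAt ℝ (fun y => -((Δ U) y)) x :=
    (differentiableAt_laplacian_of_contDiff_three hU x).fun_neg
  have hUs : DifferentiableAt ℝ (fun y => (1 / 2 : ℝ) • U y) x := hUx.fun_const_smul _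
  have hDs : DifferentiableAt ℝ (fun y => (1 / 2 : ℝ) • fderiv ℝ U y y) x :=
    (differentiableAt_fderiv_apply_self hU2 x).fun_const_smul _
  rw [curl_add (hΔ.fun_add hUs) hDs, curl_add hΔ hUs, curl_neg, curl_laplacian hU x,
    curl_const_smul hUx, curl_const_smul (differentiableAt_fderiv_apply_self hU2 x),
    curl_fderiv_apply_self hU2 x, smul_add]
  module

/-- **The registered residual in vorticity variables.**  For `U ∈ C³(ℝ³;ℝ³)`,
`g = lerayVorticityResidual U = −Δω + ω + ½Dω·y + curl((U·∇)U)`, `ω = curl U`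
(`…ForcedTsaiDefs`: `g = curl(−ΔU + ½U + ½DU·y + (U·∇)U)`). -/
theorem lerayVorticityResidual_eq_vorticityForm (hU : ContDiff ℝ 3 U) (x : E3) :
    lerayVorticityResidual U x
      = -((Δ (curl U)) x) + curl U x + (1 / 2 : ℝ) • fderiv ℝ (curl U) x x
          + curl (convect U U) x := by
  have hU2 : ContDiff ℝ 2 U := hU.of_le (by norm_num)
  have hUx : DifferentiableAt ℝ U x := (hU.differentiable (by simp)) x
  have hL : DifferentiableAt ℝ
      (fun y => -((Δ U) y) + (1 / 2 : ℝ) • U y + (1 / 2 : ℝ) • fderiv ℝ U y y) x :=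
    (((differentiableAt_laplacian_of_contDiff_three hU x).fun_neg.fun_add
      (hUx.fun_const_smul _)).fun_add
        ((differentiableAt_fderiv_apply_self hU2 x).fun_const_smul _))
  have hN : DifferentiableAt ℝ (convect U U) x := differentiableAt_convect_self hU2 x
  have hdef : lerayMomentumResidual U = fun y =>
      (-((Δ U) y) + (1 / 2 : ℝ) • U y + (1 / 2 : ℝ) • fderiv ℝ U y y) + convect U U y := rfl
  rw [lerayVorticityResidual, hdef, curl_add hL hN, curl_linearisedLeray hU x]

/-- **The registered residual of a DIVERGENCE-FREE field, stretching form**: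
`g = −Δω + ω + ½Dω·y + Dω(U) − DU(ω)` (`curl((U·∇)U) = (U·∇)ω − (ω·∇)U` for `div U = 0`):
the left side of the steady backward self-similar vorticity equation. -/
theorem lerayVorticityResidual_eq_vorticityForm_of_isDivFree (hU : ContDiff ℝ 3 U)
    (hdiv : VectorCalculus.IsDivFree U) (x : E3) :
    lerayVorticityResidual U x
      = -((Δ (curl U)) x) + curl U x + (1 / 2 : ℝ) • fderiv ℝ (curl U) x x
          + (fderiv ℝ (curl U) x (U x) - fderiv ℝ U x (curl U x)) := by
  rw [lerayVorticityResidual_eq_vorticityForm hU x,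
    curl_convect_self_of_isDivFree (hU.of_le (by norm_num)) hdiv x]
  rfl

end VorticityForm

/-! ## B. O(3) covariance of the registered residuals (LINEAR-FLOOR §2, line 2) -/

section Isometry

variable (R : E3 ≃ₗᵢ[ℝ] E3)

/-- The Leray transport term of the conjugated field: `D(R U R⁻¹)(y)[y] = R (DU(R⁻¹y)[R⁻¹y])`. -/
theorem fderiv_conj_apply_self (U : E3 → E3) (y : E3) :
    fderiv ℝ (fun z => R (U (R.symm z))) y y = R (fderiv ℝ U (R.symm y) (R.symm y)) := by
  rw [fderiv_conj_linearIsometryEquiv]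
  rfl

/-- **O(3) covariance of the registered momentum residual** (no hypotheses on `U`):
`lerayMomentumResidual (R U R⁻¹) y = R (lerayMomentumResidual U (R⁻¹ y))` — each of `Δ`, the
identity, the transport `DU·y` and the self-advection `(U·∇)U` is rotation covariant. -/
theorem lerayMomentumResidual_conj (U : E3 → E3) (y : E3) :
    lerayMomentumResidual (fun z => R (U (R.symm z))) y
      = R (lerayMomentumResidual U (R.symm y)) := by
  rw [lerayMomentumResidual, lerayMomentumResidual, laplacian_conj_linearIsometryEquiv,
    convect_conj_linearIsometryEquiv, fderiv_conj_apply_self]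
  simp only [map_add, map_neg, LinearIsometryEquiv.map_smul]

/-- Function-level form of `lerayMomentumResidual_conj`. -/
theorem lerayMomentumResidual_conj_eq (U : E3 → E3) :
    lerayMomentumResidual (fun z => R (U (R.symm z)))
      = fun y => R (lerayMomentumResidual U (R.symm y)) :=
  funext (lerayMomentumResidual_conj R U)

/-- **The registered vorticity residual is a pseudovector**:
`g_{R U R⁻¹}(y) = det R • R (g_U(R⁻¹ y))` (`det R = ±1`; no hypotheses on `U`). -/
theorem lerayVorticityResidual_conj (U : E3 → E3) (y : E3) :
    lerayVorticityResidual (fun z => R (U (R.symm z))) y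
      = (R : E3 →L[ℝ] E3).det • R (lerayVorticityResidual U (R.symm y)) := by
  rw [lerayVorticityResidual, lerayMomentumResidual_conj_eq, curl_conj_linearIsometryEquiv,
    lerayVorticityResidual]

/-- **The size of the registered vorticity residual is O(3)-invariant**:
`‖g_{R U R⁻¹}(y)‖ = ‖g_U(R⁻¹ y)‖`. -/
theorem norm_lerayVorticityResidual_conj (U : E3 → E3) (y : E3) :
    ‖lerayVorticityResidual (fun z => R (U (R.symm z))) y‖
      = ‖lerayVorticityResidual U (R.symm y)‖ := by
  rw [lerayVorticityResidual, lerayMomentumResidual_conj_eq, norm_curl_conj_linearIsometryEquiv,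
    lerayVorticityResidual]

/-- The weighted residual density transforms by composition with `R⁻¹`:
`(1+‖y‖)⁵‖g_{R U R⁻¹}(y)‖² = ((1+‖·‖)⁵‖g_U‖²)(R⁻¹ y)` (the weight is radial). -/
theorem residualWeight_conj (U : E3 → E3) (y : E3) :
    (1 + ‖y‖) ^ 5 * ‖lerayVorticityResidual (fun z => R (U (R.symm z))) y‖ ^ 2
      = (1 + ‖R.symm y‖) ^ 5 * ‖lerayVorticityResidual U (R.symm y)‖ ^ 2 := by
  rw [norm_lerayVorticityResidual_conj, LinearIsometryEquiv.norm_map]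

/-! ## C. Invariance of the two registered quadratic forms and of the witness predicates -/

/-- A linear isometry is a measurable embedding (it is a homeomorphism). -/
theorem measurableEmbedding_linearIsometryEquiv (S : E3 ≃ₗᵢ[ℝ] E3) :
    MeasurableEmbedding (S : E3 → E3) :=
  S.toHomeomorph.measurableEmbedding

/-- The ball `B₁₀` (indeed every ball about the origin) is invariant: `R⁻¹' B_r(0) = B_r(0)`. -/
theorem preimage_ball_linearIsometryEquiv (S : E3 ≃ₗᵢ[ℝ] E3) (r : ℝ) :
    (S : E3 → E3) ⁻¹' ball (0 : E3) r = ball 0 r := by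
  ext y
  simp [Metric.mem_ball, dist_zero_right]

/-- **The LEVEL is O(3)-invariant**: `‖curl (R U R⁻¹)‖_{L²(B₁₀)} = ‖curl U‖_{L²(B₁₀)}`
(`‖curl (R U R⁻¹)(y)‖ = ‖curl U (R⁻¹y)‖`, `R⁻¹` preserves Lebesgue measure and the ball). -/
theorem lerayLevel_conj (U : E3 → E3) :
    lerayLevel (fun z => R (U (R.symm z))) = lerayLevel U := by
  unfold lerayLevel
  congr 1
  have hpt : (fun y => ‖curl (fun z => R (U (R.symm z))) y‖ ^ 2)
      = fun y => ‖curl U (R.symm y)‖ ^ 2 := by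
    funext y
    rw [norm_curl_conj_linearIsometryEquiv]
  rw [hpt]
  have h := (R.symm.measurePreserving).setIntegral_preimage_emb
    (measurableEmbedding_linearIsometryEquiv R.symm) (fun y => ‖curl U y‖ ^ 2) (ball (0 : E3) 10)
  rw [preimage_ball_linearIsometryEquiv] at h
  exact h

/-- **The integrability conjunct of the currency is O(3)-invariant**. -/
theorem integrable_residualWeight_conj_iff (U : E3 → E3) :
    Integrable (fun y => (1 + ‖y‖) ^ 5 * ‖lerayVorticityResidual (fun z => R (U (R.symm z))) y‖ ^ 2)
      ↔ Integrable (fun y => (1 + ‖y‖) ^ 5 * ‖lerayVorticityResidual U y‖ ^ 2) := by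
  have h : (fun y => (1 + ‖y‖) ^ 5 * ‖lerayVorticityResidual (fun z => R (U (R.symm z))) y‖ ^ 2)
      = (fun w => (1 + ‖w‖) ^ 5 * ‖lerayVorticityResidual U w‖ ^ 2) ∘ (R.symm : E3 → E3) := by
    funext y
    rw [Function.comp_apply, residualWeight_conj]
  rw [h]
  exact (R.symm.measurePreserving).integrable_comp_emb
    (measurableEmbedding_linearIsometryEquiv R.symm)

/-- **The weighted RESIDUAL NORM is O(3)-invariant**:
`‖(1+|y|)^{5/2} g_{R U R⁻¹}‖_{L²(ℝ³)} = ‖(1+|y|)^{5/2} g_U‖_{L²(ℝ³)}`. -/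
theorem lerayResidualNorm_conj (U : E3 → E3) :
    lerayResidualNorm (fun z => R (U (R.symm z))) = lerayResidualNorm U := by
  unfold lerayResidualNorm
  congr 1
  have hpt : (fun y => (1 + ‖y‖) ^ 5 * ‖lerayVorticityResidual (fun z => R (U (R.symm z))) y‖ ^ 2)
      = fun y => (1 + ‖R.symm y‖) ^ 5 * ‖lerayVorticityResidual U (R.symm y)‖ ^ 2 := by
    funext y
    rw [residualWeight_conj]
  rw [hpt]
  exact (R.symm.measurePreserving).integral_comp (measurableEmbedding_linearIsometryEquiv R.symm)
    (fun w => (1 + ‖w‖) ^ 5 * ‖lerayVorticityResidual U w‖ ^ 2)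

/-- Smoothness is preserved by conjugation with a linear isometry. -/
theorem contDiff_conj {n : WithTop ℕ∞} {U : E3 → E3} (hU : ContDiff ℝ n U) :
    ContDiff ℝ n (fun z => R (U (R.symm z))) := by
  have h1 : ContDiff ℝ n (fun z : E3 => (R : E3 →L[ℝ] E3) z) := (R : E3 →L[ℝ] E3).contDiff
  have h2 : ContDiff ℝ n (fun z : E3 => (R.symm : E3 →L[ℝ] E3) z) :=
    (R.symm : E3 →L[ℝ] E3).contDiff
  exact h1.comp (hU.comp h2)

/-- The TYPE-I DECAY bound `‖U(y)‖ ≤ C₀/(1+‖y‖)` of the repaired currency is preserved, with the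
SAME constant `C₀` (the weight is radial). -/
theorem typeIDecay_conj {C₀ : ℝ} {U : E3 → E3} (h : ∀ y, ‖U y‖ ≤ C₀ / (1 + ‖y‖)) (y : E3) :
    ‖R (U (R.symm y))‖ ≤ C₀ / (1 + ‖y‖) := by
  calc ‖R (U (R.symm y))‖ = ‖U (R.symm y)‖ := R.norm_map _
    _ ≤ C₀ / (1 + ‖R.symm y‖) := h _
    _ = C₀ / (1 + ‖y‖) := by rw [R.symm.norm_map]

/-- **The witness predicate of `ForcedTsaiModulusLE M δ` is O(3)-stable** (same `M`, same `δ`):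
smooth, divergence free, level `≥ M`, weighted residual integrable with norm `≤ δ` — all four
survive `U ↦ R U R⁻¹`.  (§2 line 2 of LINEAR-FLOOR for the full NONLINEAR registered pair: both
quadratic forms are invariant, so every sector image of a witness is a witness with the same
numbers; the decomposition into sectors itself — §2(b) — is not formalised here.) -/
theorem forcedTsaiWitness_conj {M δ : ℝ} {U : E3 → E3}
    (h : ContDiff ℝ ∞ U ∧ VectorCalculus.IsDivFree U ∧ M ≤ lerayLevel U ∧
      Integrable (fun y => (1 + ‖y‖) ^ 5 * ‖lerayVorticityResidual U y‖ ^ 2) ∧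
        lerayResidualNorm U ≤ δ) :
    ContDiff ℝ ∞ (fun z => R (U (R.symm z))) ∧
      VectorCalculus.IsDivFree (fun z => R (U (R.symm z))) ∧
      M ≤ lerayLevel (fun z => R (U (R.symm z))) ∧
      Integrable (fun y =>
        (1 + ‖y‖) ^ 5 * ‖lerayVorticityResidual (fun z => R (U (R.symm z))) y‖ ^ 2) ∧
      lerayResidualNorm (fun z => R (U (R.symm z))) ≤ δ := by
  obtain ⟨hU, hdiv, hlev, hint, hres⟩ := h
  refine ⟨contDiff_conj R hU, hdiv.conj_linearIsometryEquiv R, ?_,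
    (integrable_residualWeight_conj_iff R U).mpr hint, ?_⟩
  · rw [lerayLevel_conj]; exact hlev
  · rw [lerayResidualNorm_conj]; exact hres

/-- **The witness predicate of the repaired currency `ForcedTsaiModulusTypeILE C₀ M δ` is
O(3)-stable** (same `C₀`, `M`, `δ`). -/
theorem forcedTsaiTypeIWitness_conj {C₀ M δ : ℝ} {U : E3 → E3}
    (h : ContDiff ℝ ∞ U ∧ VectorCalculus.IsDivFree U ∧ (∀ y, ‖U y‖ ≤ C₀ / (1 + ‖y‖)) ∧
      M ≤ lerayLevel U ∧
      Integrable (fun y => (1 + ‖y‖) ^ 5 * ‖lerayVorticityResidual U y‖ ^ 2) ∧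
        lerayResidualNorm U ≤ δ) :
    ContDiff ℝ ∞ (fun z => R (U (R.symm z))) ∧
      VectorCalculus.IsDivFree (fun z => R (U (R.symm z))) ∧
      (∀ y, ‖R (U (R.symm y))‖ ≤ C₀ / (1 + ‖y‖)) ∧
      M ≤ lerayLevel (fun z => R (U (R.symm z))) ∧
      Integrable (fun y =>
        (1 + ‖y‖) ^ 5 * ‖lerayVorticityResidual (fun z => R (U (R.symm z))) y‖ ^ 2) ∧
      lerayResidualNorm (fun z => R (U (R.symm z))) ≤ δ := by
  obtain ⟨hU, hdiv, hdec, hlev, hint, hres⟩ := h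
  obtain ⟨h1, h2, h3, h4, h5⟩ := forcedTsaiWitness_conj R ⟨hU, hdiv, hlev, hint, hres⟩
  exact ⟨h1, h2, typeIDecay_conj R hdec, h3, h4, h5⟩

/-- Corollary in the registered Prop: a witness of `ForcedTsaiModulusLE M δ` may be replaced by any
of its O(3)-conjugates (e.g. turned so that a distinguished axis is `e₃`). -/
theorem ForcedTsaiModulusLE.of_conj_witness (R : E3 ≃ₗᵢ[ℝ] E3) {M δ : ℝ} {U : E3 → E3}
    (h : ContDiff ℝ ∞ U ∧ VectorCalculus.IsDivFree U ∧ M ≤ lerayLevel U ∧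
      Integrable (fun y => (1 + ‖y‖) ^ 5 * ‖lerayVorticityResidual U y‖ ^ 2) ∧
        lerayResidualNorm U ≤ δ) :
    ForcedTsaiModulusLE M δ :=
  ⟨fun z => R (U (R.symm z)), forcedTsaiWitness_conj R h⟩

/-- The same corollary for the repaired Type-I currency. -/
theorem ForcedTsaiModulusTypeILE.of_conj_witness (R : E3 ≃ₗᵢ[ℝ] E3) {C₀ M δ : ℝ} {U : E3 → E3}
    (h : ContDiff ℝ ∞ U ∧ VectorCalculus.IsDivFree U ∧ (∀ y, ‖U y‖ ≤ C₀ / (1 + ‖y‖)) ∧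
      M ≤ lerayLevel U ∧
      Integrable (fun y => (1 + ‖y‖) ^ 5 * ‖lerayVorticityResidual U y‖ ^ 2) ∧
        lerayResidualNorm U ≤ δ) :
    ForcedTsaiModulusTypeILE C₀ M δ :=
  ⟨fun z => R (U (R.symm z)), forcedTsaiTypeIWitness_conj R h⟩

end Isometry

end Summit.NavierStokesRegularity.NavierStokesRegularity.Cruxes.ScarEnvelopeTypeI.ForcedTsai

end
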